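import Summits.MatrixMultiplication.OmegaCensus.SmallFormats.InvertiblePointFootprintSpaces
import Summits.MatrixMultiplication.OmegaCensus.SmallFormats.MatMul225GF3MarginalOrbit
import HarnessLib

/-!
# ω-census family (a): the footprint filter as a REDUCTION — catalog completeness + per-type Rado failure exclude a marginal

Cell `pub-omega` (unit `pub-omega-tensor-g32`), topic `Summits/MatrixMultiplication/OmegaCensus` (sub-folder `SmallFormats`).
Framing (verbatim): lottery ticket; floor = certified bounds/negative ranges. HONEST FRAMING: the top-level shape of the census' search-free
'footprint filter' (tensor g23 `ipfilter.py`, the (5,17)/(6,20)/(7,23) invertible-point instruments) as ONE theorem with its two finite inputs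
made explicit and NOT proved here: (C) a catalog of `d`-tuples of `2 × n` matrices that is COMPLETE for subspaces of `k^{2×n}` of dimension
`≤ d` without zero column, up to the right `GL_n`-action (for the engine: the Weierstraß–Kronecker types of `d × n` pencils — a published
classification, to be cited as a Literature fact or proved), and (R) for every catalog member a RADO FAILURE (decidable linear algebra over a
finite field). Given (C) and (R) at a saturated invertible point `X₀` of a marginal `m`, no computation of `⟨2,2,n⟩` has X-marginal `m`
(`xMarginal_ne_of_catalog`). The proof is the kernel glue only: Y-side `GL_n` transport (`BilinComp.sandwich`), the footprint law and Rado
necessity (`card_le_finrank_biSup_fpSpace`, p625599) and full column support (`exists_w_col_ne_zero_of_saturated`). Nothing on `ω`; no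
marginal is excluded in this file.
-/

namespace Summit.MatrixMultiplication.OmegaCensus.SmallFormats

open Module Matrix Literature.Computability.AlgebraicComplexity RankOnePlaneCapGeneral

variable {k : Type*} [Field k] {n : ℕ}

/-! ## X-forms from coefficient matrices -/

/-- The X-form with coefficient matrix `U`: `X ↦ Σ_{c,d} X_{cd} U_{cd}` (so that `formOf (xMarginal β i) = f_i`). -/
def formOf (U : Matrix (Fin 2) (Fin 2) k) : Module.Dual k (Matrix (Fin 2) (Fin 2) k) where
  toFun X := ∑ c, ∑ d, X c d * U c d
  map_add' X Y := by
    simp only [Matrix.add_apply, add_mul, Finset.sum_add_distrib]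
  map_smul' a X := by
    simp only [Matrix.smul_apply, smul_eq_mul, mul_assoc, ← Finset.mul_sum, RingHom.id_apply]

/-- `formOf U X = Σ_{c,d} X_{cd} U_{cd}`. -/
@[simp] theorem formOf_apply (U X : Matrix (Fin 2) (Fin 2) k) : formOf U X = ∑ c, ∑ d, X c d * U c d := rfl

/-- The X-forms of a computation are the forms of its X-marginal. -/
theorem f_eq_formOf_xMarginal {ι : Type*} [Fintype ι] (β : BilinComp (mulBilin k 2 2 n) ι) (i : ι) :
    β.f i = formOf (xMarginal β i) := by
  ext X
  rw [formOf_apply, f_apply_eq_sum_xMarginal]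

/-! ## The two finite inputs -/

/-- **(C) Catalog completeness.** A list `cat` of `d`-tuples of `2 × n` matrices is complete if every subspace `WW ⊆ k^{2×n}`
of dimension `≤ d` in which no column is identically zero is carried, by some invertible right multiplication `W ↦ W Q`, INTO
the span of a catalog tuple. (For `d × n` pencils this is the Weierstraß–Kronecker classification up to strict equivalence,
with the members of dimension `< d` enlarged; it is an INPUT here.) -/
def CatalogComplete (n d : ℕ) (cat : List (Fin d → Matrix (Fin 2) (Fin n) k)) : Prop :=
  ∀ WW : Submodule k (Matrix (Fin 2) (Fin n) k), finrank k WW ≤ d →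
    (∀ c : Fin n, ∃ W ∈ WW, ∃ r, W r c ≠ 0) →
    ∃ b ∈ cat, ∃ Q Q' : Matrix (Fin n) (Fin n) k, Q' * Q = 1 ∧
      WW.map (mulRightLin k Q) ≤ Submodule.span k (Set.range b)

/-- **(R) Rado failure** of the marginal `m` at the point `X₀` against the catalog tuple `b`: some set `T` of off-terms
(`f_j(X₀) ≠ 0`) is larger than the dimension of the sum of its admissible spaces `B_{ker f_j}(span b)`. Decidable linear
algebra for explicit data over a finite field (the engine's Rado test, negated). -/
def RadoFails {r d : ℕ} (m : Fin r → Matrix (Fin 2) (Fin 2) k) (X₀ : Matrix (Fin 2) (Fin 2) k)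
    (b : Fin d → Matrix (Fin 2) (Fin n) k) : Prop :=
  ∃ T : Finset (Fin r), (∀ j ∈ T, formOf (m j) X₀ ≠ 0) ∧
    finrank k (⨆ j ∈ T, fpSpace (LinearMap.ker (formOf (m j))) (Submodule.span k (Set.range b)) :
      Submodule k (Matrix (Fin 2) (Fin n) k)) < T.card

/-! ## The reduction -/

/-- **Footprint exclusion from a complete catalog.** Let `m` be an X-marginal of length `r` and `X₀` an invertible point at
which exactly `r − 2n` of the forms of `m` vanish (a SATURATED point). If a catalog `cat` is complete for dimension `r − 2n`
(input (C)) and `m` fails Rado at `X₀` against every member of `cat` (input (R)), then no computation of `⟨2,2,n⟩` with `r`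
products has X-marginal `m`. -/
theorem xMarginal_ne_of_catalog [DecidableEq k] {r d : ℕ} (m : Fin r → Matrix (Fin 2) (Fin 2) k)
    (X₀ : Matrix (Fin 2) (Fin 2) k) (hX₀ : IsUnit X₀.det)
    (hsat : (Finset.univ.filter fun i => formOf (m i) X₀ = 0).card + 2 * n = r) (hd : d + 2 * n = r)
    (cat : List (Fin d → Matrix (Fin 2) (Fin n) k)) (hcat : CatalogComplete n d cat)
    (hkill : ∀ b ∈ cat, RadoFails m X₀ b) (β : BilinComp (mulBilin k 2 2 n) (Fin r)) : xMarginal β ≠ m := by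
  intro hm
  have hf : ∀ i, β.f i = formOf (m i) := fun i => by rw [f_eq_formOf_xMarginal, hm]
  -- the off-terms at X₀
  obtain ⟨O, hOdef⟩ : ∃ O : Finset (Fin r), O = Finset.univ.filter (fun i => ¬ formOf (m i) X₀ = 0) := ⟨_, rfl⟩
  have hO : ∀ i, i ∉ O → β.f i X₀ = 0 := fun i hi => by
    by_contra h
    rw [hf] at h
    exact hi (hOdef ▸ Finset.mem_filter.mpr ⟨Finset.mem_univ i, h⟩)
  have hO' : ∀ i ∈ O, β.f i X₀ ≠ 0 := fun i hi => by
    rw [hf]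
    rw [hOdef] at hi
    exact (Finset.mem_filter.mp hi).2
  have hcard : O.card = 2 * n := by
    have h := Finset.card_filter_add_card_filter_not (s := (Finset.univ : Finset (Fin r)))
      (fun i : Fin r => formOf (m i) X₀ = 0)
    rw [← hOdef, Finset.card_univ, Fintype.card_fin] at h
    omega
  -- the footprint space `span{W_i : i ∉ O}`: dimension ≤ d and full column support
  have hdim : finrank k (Submodule.span k (β.w '' {i | i ∉ O})) ≤ d := by
    have h := finrank_span_w_compl_le β O
    rw [Fintype.card_fin, hcard] at h
    omega
  have hsupp : ∀ c : Fin n, ∃ W ∈ Submodule.span k (β.w '' {i | i ∉ O}), ∃ ρ, W ρ c ≠ 0 := by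
    intro c
    obtain ⟨i, hi, ρ, hρ⟩ := exists_w_col_ne_zero_of_saturated β X₀ hX₀ O hO hO' hcard c
    exact ⟨β.w i, Submodule.subset_span ⟨i, hi, rfl⟩, ρ, hρ⟩
  obtain ⟨b, hb, Q, Q', hQ, hle⟩ := hcat _ hdim hsupp
  -- transport the computation along `Y ↦ Y Q`
  set β' := β.sandwich 1 1 Q Q' (Matrix.one_mul 1) hQ with hβ'
  have hf' : ∀ i, β'.f i = β.f i := fun i => by
    ext X; rw [hβ', BilinComp.sandwich_f, Matrix.one_mul]
  have hw' : ∀ i, β'.w i = β.w i * Q := fun i => by rw [hβ', BilinComp.sandwich_w, Matrix.one_mul]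
  have hO₁ : ∀ i, i ∉ O → β'.f i X₀ = 0 := fun i hi => by rw [hf']; exact hO i hi
  have hO₁' : ∀ i ∈ O, β'.f i X₀ ≠ 0 := fun i hi => by rw [hf']; exact hO' i hi
  have hWW' : Submodule.span k (β'.w '' {i | i ∉ O}) ≤ Submodule.span k (Set.range b) := by
    refine Submodule.span_le.mpr ?_
    rintro _ ⟨i, hi, rfl⟩
    rw [hw']
    exact hle (Submodule.mem_map_of_mem (f := mulRightLin k Q) (Submodule.subset_span ⟨i, hi, rfl⟩))
  -- Rado necessity for β' against Rado failure for b
  obtain ⟨T, hT, hlt⟩ := hkill b hb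
  have hTO : T ⊆ O := fun j hj => hOdef ▸ Finset.mem_filter.mpr ⟨Finset.mem_univ j, hT j hj⟩
  have hle' := card_le_finrank_biSup_fpSpace β' X₀ hX₀ O hO₁ hO₁' hcard (Submodule.span k (Set.range b)) hWW' T hTO
  have hsup : (⨆ j ∈ T, fpSpace (LinearMap.ker (β'.f j)) (Submodule.span k (Set.range b)) :
      Submodule k (Matrix (Fin 2) (Fin n) k)) =
      ⨆ j ∈ T, fpSpace (LinearMap.ker (formOf (m j))) (Submodule.span k (Set.range b)) := by
    refine iSup_congr fun j => iSup_congr fun _ => ?_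
    rw [hf', hf]
  rw [hsup] at hle'
  omega

end Summit.MatrixMultiplication.OmegaCensus.SmallFormats
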